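import Summits.BirchSwinnertonDyer.BirchSwinnertonDyer.Theorems.KolyvaginDepthDoorMSymbolCert664a1Core0
import Summits.BirchSwinnertonDyer.BirchSwinnertonDyer.Theorems.KolyvaginDepthDoorMSymbolCert664a1Core1
import Summits.BirchSwinnertonDyer.BirchSwinnertonDyer.Theorems.KolyvaginDepthDoorMSymbolCert664a1Inv0
import Summits.BirchSwinnertonDyer.BirchSwinnertonDyer.Theorems.KolyvaginDepthDoorMSymbolCert664a1Inv1
import HarnessLib

/-!
# Route `KolyvaginDepthDoor`, crux `KolyvaginDepthSupplyKN` (stmt-BirchSwinnertonDyer-22820) —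
# DEPTH TABLE v30, DATA of `664a1`, part 3: the pool part and the assembled check `cert664a1_check`

Helper file of the lead prover of line `levelone` (kdd-p1 g35; `--supports stmt-BirchSwinnertonDyer-22820 --as helper`);
MACHINE-WRITTEN DATA + `decide` (generator `work/py/genq_lean.py`, kit 1″ `…MSymbolCertCosetsQ/CosetsCQ`). Part 3 of the check of `…MSymbolCert664a1` (`partPool`) and the assembled `checkF` (kits 2c–2e `checkF_of_parts`). It closes nothing and BSD is NOT proved by it.

References: [CremonaAlgorithms1997] §2.2–2.5, §2.8, Table 1 (664a1); [PopaZagier2017] §4 (13); [Kim2022StructureSelmer] §1.4.3;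
[MazurTateTeitelbaum1986Invent] §I.8.
-/

set_option linter.dupNamespace false
-- the packed numerals are long literals
set_option linter.style.longLine false

noncomputable section

open scoped MatrixGroups ModularForm
open CongruenceSubgroup
open Literature.NumberTheory.EllipticCurves Literature.NumberTheory.EllipticCurves.ModularForms
open Literature.NumberTheory.Automorphic.PopaZagier (coeff12 coeff12M coeff coeffN)
open Summit.BirchSwinnertonDyer.BirchSwinnertonDyer.Rank2Observatory
open Summit.BirchSwinnertonDyer.BirchSwinnertonDyer.Rank1Residual (IntModel.frobeniusTrace_eq IntModel.minimalDiscriminantInt_eq)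
open Summit.BirchSwinnertonDyer.BirchSwinnertonDyer.Theorems.KolyvaginDepthDoor.MSymbolCert.Cert389a1
  (H3 H3fin support_subset_H3fin H3fin_det H3mat_nodup H3_det H3_coeff eval_map eval_append)

namespace Summit.BirchSwinnertonDyer.BirchSwinnertonDyer.Theorems.KolyvaginDepthDoor.MSymbolCert.Cert664a1

/-! ## §1 Part 3 of the check; the check -/

set_option maxHeartbeats 4000000 in
/-- **Certificate part 3 and the check**: `φ` satisfies the pool (chunked kernel checks) — with parts 1, 2a, 2b the
certificate checks (kits 2c–2e `checkF_of_parts`). [folklore] -/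
theorem cert664a1_check : cert664a1.checkF gen664a1 5040 1008 phi664a1 = true := by
  have hq0 : (List.range' 0 750).all (fun k => evalInt phi664a1 (gen664a1 k) == 0) = true := by decide +kernel
  have hq1 : (List.range' 750 750).all (fun k => evalInt phi664a1 (gen664a1 k) == 0) = true := by decide +kernel
  have hq2 : (List.range' 1500 750).all (fun k => evalInt phi664a1 (gen664a1 k) == 0) = true := by decide +kernel
  have hq3 : (List.range' 2250 750).all (fun k => evalInt phi664a1 (gen664a1 k) == 0) = true := by decide +kernel
  have hq4 : (List.range' 3000 750).all (fun k => evalInt phi664a1 (gen664a1 k) == 0) = true := by decide +kernel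
  have hq5 : (List.range' 3750 750).all (fun k => evalInt phi664a1 (gen664a1 k) == 0) = true := by decide +kernel
  have hq6 : (List.range' 4500 540).all (fun k => evalInt phi664a1 (gen664a1 k) == 0) = true := by decide +kernel
  have hpool : cert664a1.partPool gen664a1 5040 phi664a1 = true :=
    cert664a1.partPool_of_forall _ _ _ (fun k hk => by
      by_cases c0 : k < 750
      · exact evalInt_chunk hq0 k (by omega) (by omega)
      by_cases c1 : k < 1500
      · exact evalInt_chunk hq1 k (by omega) (by omega)
      by_cases c2 : k < 2250
      · exact evalInt_chunk hq2 k (by omega) (by omega)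
      by_cases c3 : k < 3000
      · exact evalInt_chunk hq3 k (by omega) (by omega)
      by_cases c4 : k < 3750
      · exact evalInt_chunk hq4 k (by omega) (by omega)
      by_cases c5 : k < 4500
      · exact evalInt_chunk hq5 k (by omega) (by omega)
      exact evalInt_chunk hq6 k (by omega) (by omega)) (by decide +kernel)
  have hcore : cert664a1.partCore gen664a1 = true :=
    cert664a1.partCore_of_forall _ (fun k hk => by
      have hm1 : cert664a1.m - 1 = 87 := rfl
      by_cases c0 : k < 44
      · exact cert664a1_coreRows0 k (by omega) c0
      exact cert664a1_coreRows1 k (by omega) (by omega))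
  have hinv : cert664a1.partInv = true :=
    cert664a1.partInv_of_forall (fun k hk => by
      have hm1 : cert664a1.m - 1 = 87 := rfl
      by_cases c0 : k < 44
      · exact cert664a1_invRows0 k (by omega) c0
      exact cert664a1_invRows1 k (by omega) (by omega))
  exact cert664a1.checkF_of_parts _ _ _ _ cert664a1_partPeel hcore hinv hpool

end Summit.BirchSwinnertonDyer.BirchSwinnertonDyer.Theorems.KolyvaginDepthDoor.MSymbolCert.Cert664a1

end
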